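import Summits.BirchSwinnertonDyer.BirchSwinnertonDyer.Theorems.GenusKolyvaginAtTwoK4NegPhantomCellHalvingBit
import HarnessLib

/-!
# Route `GenusKolyvaginAtTwo`, crux K₄⁻ `K4Neg` (stmt-BirchSwinnertonDyer-31526), the (β)-residual F4ᶠ —
# THE ONE-BIT-SHORT DESCENT IS UNCONDITIONAL: «hQuarter» never fails

Width seat `bsd-line-gk2-p5` g43 (cell `bsd-f1-sign2`), WIDTH-5 attach on route `GenusKolyvaginAtTwo` rev 59, lane «the (β)-residual of K₄⁻».
`--supports stmt-BirchSwinnertonDyer-31526 --as helper`.  THEOREMS ONLY (no definition, no named fact, no `sorry`); standard axioms.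
**BSD is NOT proved by this file; `K4Neg` is NOT proved; no item is closed by it.**

WHY.  The LEAD road (gk2-p1 g28, `…K4NegPhantomCellHalvingBit`) proves K4Neg's conclusion on every `Δ < 0` frame from `BSD₂(E) + BSD₂(Wd) + Q2 +
PRINT` and ONE bit `hHalf` := «a `K`-point halvable by a `Γ_{K(E[4])}`-fixed point is halvable in `E(K)`», via the all-level descent `hDesc`
(`exists_zsmul_eq_of_fixed_root_of_halvingBit`: a `K`-point with a `2^M`-th root fixed by `Γ_{K(E[2^(M+2))}` is `2^M`-divisible in `E(K)`).  On the
(β)-frames `hHalf` FAILS (gk2-p3 g34 `PhantomDescentBit.not_hHalf_iff_exists_kummer_eq_resTorsion`: the twin's generator IS halvable over `K(E[4])`).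
THIS FILE records, as standalone theorems, that the failure is EXACTLY ONE BIT DEEP and cannot compound with the level:

* §1 ★ `exists_zsmul_pred_eq_of_torsionFixing_fixed_root` — **ONE-BIT-SHORT DESCENT, UNCONDITIONAL on the frame**: `E/ℚ` with `ρ_{E,2^n}` onto for
  all `n`, `K` imaginary quadratic with odd `d_K` and the two Theorem-B₂ non-squares; if `P ∈ E(K)` has a `2^M`-th root `Q ∈ E(K̄)` (`M ≥ 1`) fixed
  by `Γ_{K(E[2^L])}` for some `L ≥ M`, then **`P ∈ 2^(M−1) E(K)`**.  (The LEAD's proof of `hDesc ⟸ hHalf` up to its last step, re-cut: the Kummer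
  class `κ_(2^M)(P) = [σ ↦ σQ − Q]` dies on `Γ_{K(E[2^L])}`, its lift to level `2^L` is `2`-torsion by Lawson–Wuthrich over `K`, so `2P ∈ 2^M E(K)`
  and `E(K)[2] = 0`.)  No `hHalf`, no (α)-datum, no (NPh_K).
* §2 ★★ `exists_two_zsmul_eq_of_fixed_fourth_root` — **«hQuarter» HOLDS on every frame**: a `K`-point with a QUARTER fixed by `Γ_{K(E[2^L])}`
  (`L ≥ 2`) is halvable in `E(K)`.  Contrast: `hHalf` (a HALF fixed by `Γ_{K(E[4])}` ⟹ halvable in `E(K)`) is false on (β)-frames.  So the LEAD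
  road's residual is one bit at every level `M` (it asks `2^M`, the frame gives `2^(M−1)` for free), never two.
* §3 `forall_exists_torsionFixing_smul_ne_of_not_two_dvd` — point form for the companion files `…BetaFrameDeepPrimeOneBit/TopBit` (gk2-p5 g43,
  p792036): for `R ∉ 2E(K)` NO quarter of `R` is fixed by `Γ_{K(E[2^L])}` (`L ≥ 2`) — the level-`4` Kummer class of the generator is never a
  phantom at any level, which is hypothesis (i) («`Q` is moved by `Γ_{(E[4]),Q'}`») of the top-bit visibility theorem there, discharged.

READING (census; nothing closed).  With gk2-p5 g43's one-bit law (a deep Kolyvagin prime sees exactly the top bit of `κ₄`) this pins the (β)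
residual F4ᶠ of LINE 34/37 from both sides: the descent is short by exactly the bit `hHalf`, and that bit is carried by a class (`κ₄` of the
generator) that is visible — one bit at a time — to the deep primes.  BSD is NOT proved by any of this.

References: [LawsonWuthrich2016] §3 (Lemma 3, Thm. 1), §7.1; [SilvermanAEC2009] VIII.§2 (Kummer sequence), X.4; [McCallumLMS1991] §4 Lemma 4.6;
[GrossLMS1991] §9 Prop. 9.1.
-/

set_option autoImplicit false
-- the Theorems namespace of this sub repeats the summit name by design (D-0017 nested layout)
set_option linter.dupNamespace false

noncomputable section

open scoped Classical AddSubgroup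

namespace Summit.BirchSwinnertonDyer.BirchSwinnertonDyer.Theorems.GenusExact.Lw2PhantomExclusion.OneBitDescent

open WeierstrassCurve NumberField IsDedekindDomain Field Rat.HeightOneSpectrum Literature.NumberTheory.EllipticCurves
  Literature.NumberTheory.GaloisRepresentations AddSubgroup
open Summit.BirchSwinnertonDyer.BirchSwinnertonDyer.Theorems.GenusExact
open Summit.BirchSwinnertonDyer.BirchSwinnertonDyer.Theorems.GenusExact.PlusDescent

universe u

/-! ## §1 ★ The one-bit-short descent, unconditional on the frame -/

/-- ★ **ONE-BIT-SHORT DESCENT (unconditional on the frame).**  `E/ℚ` elliptic with `ρ_{E,2^n}` onto for all `n`; `K` imaginary quadratic with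
`d_K` odd and `d_K·(−|Δ|)`, `d_K·(−2|Δ|)` non-squares.  If `P ∈ E(K)` has a `2^M`-th root `Q ∈ E(K̄)` (`M ≥ 1`) fixed by `Γ_{K(E[2^L])}` for some
`L ≥ M`, then `P ∈ 2^(M−1) E(K)`.  Proof (= LEAD gk2-p1 g28's `exists_zsmul_eq_of_fixed_root_of_halvingBit`, p788592, WITHOUT its last
`hHalf` step): `κ_(2^M)(P) = [σ ↦ σQ − Q]` dies on `Γ_{K(E[2^L])}`; its (injective) lift to `H¹(K, E[2^L])` dies there too, hence is killed
by `2` (Lawson–Wuthrich over `K`, `VisiblePairAtTwo.two_zsmul_eq_zero_of_forall_h1Eval_eq_zero_habitat`); so `κ_(2^M)(2P) = 0`,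
`2P = 2^M R₀`, and `P = 2^(M−1) R₀` because `E(K)[2] = 0`. [cite: LawsonWuthrich2016, §3 (Lemma 3, Thm. 1), §7.1]
[cite: SilvermanAEC2009, VIII.§2] -/
theorem exists_zsmul_pred_eq_of_torsionFixing_fixed_root
    (W : WeierstrassCurve ℚ) [W.IsElliptic] (K : Type) [Field K] [NumberField K] (hIQ : IsImaginaryQuadratic K)
    (hodd : Odd (NumberField.discr K)) (hsq1 : ¬ IsSquare ((NumberField.discr K : ℚ) * -|W.Δ|))
    (hsq2 : ¬ IsSquare ((NumberField.discr K : ℚ) * (-(2 * |W.Δ|)))) (hρ : ∀ n : ℕ, 0 < n → W.HasSurjectiveModNGaloisRep ((2 : ℤ) ^ n))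
    (P : (W.baseChange K).toAffine.Point) {M L : ℕ} (hM : 1 ≤ M) (hML : M ≤ L) (Q : geomPoints (W.baseChange K))
    (hQfix : ∀ ρ ∈ torsionFixing (W.baseChange K) ((2 ^ L : ℕ) : ℤ), ρ • Q = Q)
    (hQ : ((2 ^ M : ℕ) : ℤ) • Q = toGeomPoints (W.baseChange K) P) :
    ∃ R : (W.baseChange K).toAffine.Point, ((2 ^ (M - 1) : ℕ) : ℤ) • R = P := by
  -- adapted from LEAD gk2-p1 g28 `PlusDescent.exists_zsmul_eq_of_fixed_root_of_halvingBit` (p788592), last step removed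
  haveI : Fact (Nat.Prime 2) := ⟨Nat.prime_two⟩
  haveI hell : (W.baseChange K).IsElliptic := inferInstanceAs ((W.map (algebraMap ℚ K)).IsElliptic)
  obtain ⟨m, rfl⟩ : ∃ m, M = m + 1 := ⟨M - 1, by omega⟩
  have h2 : Module.finrank ℚ K = 2 := hIQ.1
  have hs2 : W.HasSurjectiveModNGaloisRep 2 := by simpa using hρ 1 one_pos
  have htorsK : ∀ (k : ℕ) (P : (W.baseChange K).toAffine.Point), ((2 ^ k : ℕ) : ℤ) • P = 0 → P = 0 := fun k P hP ↦
    EigenClassesFinite.forall_zsmul_two_pow_baseChange_eq_zero_of_hasSurjectiveModNGaloisRep_two W K h2 hs2 k P (by exact_mod_cast hP)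
  have hbotK : AddSubgroup.torsionBy (W.baseChange K).toAffine.Point ((2 : ℕ) : ℤ) = ⊥ := by
    rw [eq_bot_iff]; intro P hP; rw [AddSubgroup.mem_bot]; exact htorsK 1 P (by simpa using hP)
  -- the Kummer class `c = κ_(2^M)(P) = [σ ↦ σQ − Q]`
  have hn0 : ((2 ^ (m + 1) : ℕ) : ℤ) ≠ 0 := by positivity
  have hdivM : ∀ P : geomPoints (W.baseChange K), ∃ Q : geomPoints (W.baseChange K), ((2 ^ (m + 1) : ℕ) : ℤ) • Q = P :=
    (W.baseChange K).zsmul_geomPoints_surjective_of_charZero hn0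
  set δ := kummerMapTorsion (W.baseChange K) ((2 ^ (m + 1) : ℕ) : ℤ) hdivM with hδ
  have hκ : δ P = kummerClassTorsion (W.baseChange K) ((2 ^ (m + 1) : ℕ) : ℤ) Q (by rw [hQ]; exact toGeomPoints_mem_fixedPoints _ _) := by
    rw [hδ, kummerMapTorsion_apply]
    exact kummerMapTorsionFun_eq (W.baseChange K) _ hdivM P Q hQ
  have hdvdL : ((2 ^ (m + 1) : ℕ) : ℤ) ∣ ((2 ^ L : ℕ) : ℤ) := natCast_pow_dvd_natCast_pow (p := 2) hML
  have hLle : torsionFixing (W.baseChange K) ((2 ^ L : ℕ) : ℤ) ≤ torsionFixing (W.baseChange K) ((2 ^ (m + 1) : ℕ) : ℤ) :=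
    KolyvaginLowerBoundAtTwo.torsionFixing_le_of_dvd _ hdvdL
  have hc : ∀ ρ ∈ torsionFixing (W.baseChange K) ((2 ^ L : ℕ) : ℤ), h1Eval (W.baseChange K) ((2 ^ (m + 1) : ℕ) : ℤ) (δ P) ρ = 0 := by
    intro ρ hρ'
    rw [hκ, ← ZeroMemClass.coe_eq_zero, GenusKolyTwistingPrime.coe_h1Eval_kummerClassTorsion (W.baseChange K) _ Q _ (hLle hρ'), hQfix ρ hρ',
      sub_self]
  -- `2c = 0` (Lawson–Wuthrich over `K`, at level `2^L`)
  have hιinj : Function.Injective (torsionH1OfDvd (W.baseChange K) hdvdL) :=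
    VisiblePairAtTwo.torsionH1OfDvd_pow_injective (W.baseChange K) (p := 2) hbotK hdvdL
  have h2c : (2 : ℤ) • δ P = 0 := by
    apply hιinj
    rw [map_zsmul, map_zero]
    refine VisiblePairAtTwo.two_zsmul_eq_zero_of_forall_h1Eval_eq_zero_habitat W K L hIQ hodd hsq1 hsq2 hρ _ fun ρ ↦ ?_
    exact (Lw2PhantomExclusion.h1Eval_torsionH1OfDvd_eq_zero_iff (W.baseChange K) hdvdL _ ρ.2).mpr (hc ρ.1 ρ.2)
  -- `2P = 2^M R₀`, hence `P = 2^(M−1) R₀`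
  obtain ⟨R₀, hR₀⟩ : ∃ R₀ : (W.baseChange K).toAffine.Point, ((2 ^ (m + 1) : ℕ) : ℤ) • R₀ = (2 : ℤ) • P := by
    have hmem : (2 : ℤ) • P ∈ (kummerMapTorsion (W.baseChange K) ((2 ^ (m + 1) : ℕ) : ℤ) hdivM).ker := by
      rw [AddMonoidHom.mem_ker, map_zsmul, ← hδ, h2c]
    rw [kummerMapTorsion_ker] at hmem
    obtain ⟨R₀, hR₀⟩ := hmem
    exact ⟨R₀, by simpa using hR₀⟩
  refine ⟨R₀, ?_⟩
  have h0 : (2 : ℤ) • (((2 ^ m : ℕ) : ℤ) • R₀ - P) = 0 := by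
    rw [zsmul_sub, smul_smul, show (2 : ℤ) * ((2 ^ m : ℕ) : ℤ) = ((2 ^ (m + 1) : ℕ) : ℤ) by push_cast; ring, hR₀, sub_self]
  have h := sub_eq_zero.mp (htorsK 1 _ (by simpa using h0))
  simpa using h

/-! ## §2 ★★ «hQuarter» holds on every frame -/

/-- ★★ **«hQuarter» NEVER FAILS.**  Same frame.  A `K`-rational point with a QUARTER fixed by `Γ_{K(E[2^L])}` (`L ≥ 2`) is halvable in `E(K)`:
`∀ R Q, (∀ ρ ∈ Γ_{K(E[2^L])}, ρQ = Q) → 4Q = R → ∃ R', 2R' = R`.  Contrast with the LEAD's `hHalf` («a HALF fixed by `Γ_{K(E[4])}` ⟹ halvable»),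
which FAILS on the (β)-frames: the descent's deficit there is exactly one bit. [cite: LawsonWuthrich2016, §7.1] [cite: SilvermanAEC2009, VIII.§2] -/
theorem exists_two_zsmul_eq_of_fixed_fourth_root
    (W : WeierstrassCurve ℚ) [W.IsElliptic] (K : Type) [Field K] [NumberField K] (hIQ : IsImaginaryQuadratic K)
    (hodd : Odd (NumberField.discr K)) (hsq1 : ¬ IsSquare ((NumberField.discr K : ℚ) * -|W.Δ|))
    (hsq2 : ¬ IsSquare ((NumberField.discr K : ℚ) * (-(2 * |W.Δ|)))) (hρ : ∀ n : ℕ, 0 < n → W.HasSurjectiveModNGaloisRep ((2 : ℤ) ^ n))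
    {L : ℕ} (hL : 2 ≤ L) (R : (W.baseChange K).toAffine.Point) (Q : geomPoints (W.baseChange K))
    (hQfix : ∀ ρ ∈ torsionFixing (W.baseChange K) ((2 ^ L : ℕ) : ℤ), ρ • Q = Q) (hQ : (4 : ℤ) • Q = toGeomPoints (W.baseChange K) R) :
    ∃ R' : (W.baseChange K).toAffine.Point, (2 : ℤ) • R' = R := by
  have hQ' : ((2 ^ 2 : ℕ) : ℤ) • Q = toGeomPoints (W.baseChange K) R := by norm_num; exact hQ
  obtain ⟨R', hR'⟩ := exists_zsmul_pred_eq_of_torsionFixing_fixed_root W K hIQ hodd hsq1 hsq2 hρ R (M := 2) (by norm_num) hL Q hQfix hQ'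
  exact ⟨R', by simpa using hR'⟩

/-- ★★ **«hQuarter» at the LEAD's own level `4·4 = 16`** (the shape `Γ_{K(E[2^(M+2)])}`, `M = 2`, of `exists_zsmul_eq_of_fixed_root_of_halvingBit`):
a `K`-point with a quarter fixed by `Γ_{K(E[16])}` is halvable in `E(K)` — no `hHalf` needed. [cite: LawsonWuthrich2016, §7.1] -/
theorem exists_two_zsmul_eq_of_fixed_fourth_root_sixteen
    (W : WeierstrassCurve ℚ) [W.IsElliptic] (K : Type) [Field K] [NumberField K] (hIQ : IsImaginaryQuadratic K)
    (hodd : Odd (NumberField.discr K)) (hsq1 : ¬ IsSquare ((NumberField.discr K : ℚ) * -|W.Δ|))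
    (hsq2 : ¬ IsSquare ((NumberField.discr K : ℚ) * (-(2 * |W.Δ|)))) (hρ : ∀ n : ℕ, 0 < n → W.HasSurjectiveModNGaloisRep ((2 : ℤ) ^ n))
    (R : (W.baseChange K).toAffine.Point) (Q : geomPoints (W.baseChange K))
    (hQfix : ∀ ρ ∈ torsionFixing (W.baseChange K) (16 : ℤ), ρ • Q = Q) (hQ : (4 : ℤ) • Q = toGeomPoints (W.baseChange K) R) :
    ∃ R' : (W.baseChange K).toAffine.Point, (2 : ℤ) • R' = R :=
  exists_two_zsmul_eq_of_fixed_fourth_root W K hIQ hodd hsq1 hsq2 hρ (L := 4) (by norm_num) R Q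
    (fun ρ hρ' ↦ hQfix ρ (by norm_num at hρ'; exact hρ')) hQ

/-! ## §3 Point form: the generator's quarters are moved by every `Γ_{K(E[2^L])}` -/

/-- **For `R ∉ 2E(K)`, NO quarter of `R` is fixed by `Γ_{K(E[2^L])}` (`L ≥ 2`)**: some `ρ` fixing `E[2^L]` moves `Q` (`4Q = R`).  So the
level-`4` Kummer class of a non-halvable `K`-point is not a phantom at ANY level — hypothesis (i) of gk2-p5 g43's top-bit visibility theorem
(`DeepPrimeOneBit.exists_conj_sq_smul_sub_ne_…`, read over `K`), discharged on the frame. [cite: LawsonWuthrich2016, §7.1] [cite: GrossLMS1991, §9 Prop. 9.1] -/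
theorem forall_exists_torsionFixing_smul_ne_of_not_two_dvd
    (W : WeierstrassCurve ℚ) [W.IsElliptic] (K : Type) [Field K] [NumberField K] (hIQ : IsImaginaryQuadratic K)
    (hodd : Odd (NumberField.discr K)) (hsq1 : ¬ IsSquare ((NumberField.discr K : ℚ) * -|W.Δ|))
    (hsq2 : ¬ IsSquare ((NumberField.discr K : ℚ) * (-(2 * |W.Δ|)))) (hρ : ∀ n : ℕ, 0 < n → W.HasSurjectiveModNGaloisRep ((2 : ℤ) ^ n))
    {R : (W.baseChange K).toAffine.Point} (hR : ¬ ∃ R' : (W.baseChange K).toAffine.Point, (2 : ℤ) • R' = R)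
    {L : ℕ} (hL : 2 ≤ L) (Q : geomPoints (W.baseChange K)) (hQ : (4 : ℤ) • Q = toGeomPoints (W.baseChange K) R) :
    ∃ ρ ∈ torsionFixing (W.baseChange K) ((2 ^ L : ℕ) : ℤ), ρ • Q ≠ Q := by
  by_contra hcon
  push Not at hcon
  exact hR (exists_two_zsmul_eq_of_fixed_fourth_root W K hIQ hodd hsq1 hsq2 hρ hL R Q hcon hQ)

end Summit.BirchSwinnertonDyer.BirchSwinnertonDyer.Theorems.GenusExact.Lw2PhantomExclusion.OneBitDescent

end
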